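import Summits.RiemannHypothesis.RiemannHypothesis.Theorems.PfPersistenceParityMassLawOdd
import HarnessLib

/-!
# PF persistence — the SHARP PARITY-MASS LAW: a nodeless profile keeps AT LEAST HALF of its mass on the kept parity
class, with defect = the half-period autocorrelation (pub-rhpf, cand-6 gen 6)

**HONEST FRAMING. This is a long-odds MECHANISM SEARCH ('mechanism/rigidity campaign'); no RH claims.** RH-free, weight-free
trigonometry + Parseval on the cell's cosine / sine profiles; nothing here bears on the truth of RH. Labels: PROVED =
kernel-checked here or in the imported tree files; DATA = rows of record, clearly marked.

THE SHARPENING. `PfPersistenceParityMassLaw(Odd)` (b774012750c5 / b7c943517883) proved `‖u‖² ≤ 8 ‖u^{ev}‖²` for a one-signed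
profile from a POINTWISE domination. The exact bookkeeping is an `L²` identity: with `flip u` the parity flip
(`θ_{flip u}(x) = θ_u(x + L/2)`, resp. `θ⁻_{flipOdd u}(x) = θ⁻_u(L/2 − x)`) and Parseval,
  `2 ‖u^{ev}‖² = ‖u‖² + ⟨u, flip u⟩`,  `⟨u, flip u⟩ = ∫_{−L/2}^{L/2} θ_u(x) θ_u(x + L/2) dx`  (PROVED `two_mul_evenMass_eq`,
  `dotProduct_flipVec_eq_integral`) — the HALF-PERIOD AUTOCORRELATION of the profile; odd sector: `2 ‖u^{om}‖² = ‖u‖² +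
  ∫ θ⁻_u(x) θ⁻_u(L/2 − x) dx` (`two_mul_oddModeMass_eq`, `dotProduct_flipVecOdd_eq_integral`).
A one-signed profile (periodic, so one-signed on all of `ℝ`; odd sector: one-signed on `H`, antisymmetric) has a NONNEGATIVE
integrand pointwise (`exists_halfPeriod_partner`; odd: the reflection pairs `x ↦ L/2 − x` on `H` and `x ↦ −x, L/2 + x` off `H`), so:

* **SHARP PARITY-MASS LAW (PROVED `parityMass_two_le_of_oneSigned`, `parityMassOdd_two_le_of_oneSignedOdd`):**
  `OneSigned ⇒ ‖u‖² ≤ 2 ‖u^{ev}‖²` (even-indexed mass fraction `m_ev ≥ 1/2`), `OneSignedOdd ⇒ ‖u‖² ≤ 2 ‖u^{om}‖²` — with EQUALITY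
  iff the profile is `L²`-orthogonal to its half-period translate / reflection. The constant `2` is best possible.
* FLOORED (PROVED `parityMass_two_le_of_floorOneSigned`, `…Odd`): `FloorOneSigned φ ⇒ (1 − (2φ + φ²)(2N+1)) ‖u‖² ≤ 2 ‖u^{ev}‖²`;
  odd: `(1 − (2φ + φ²)·2N) ‖u‖² ≤ 2 ‖u^{om}‖²` — for the floors of record (`φ = 10⁻²⁰`, `N ≤ 10³`) the correction is `< 10⁻¹⁶`.

DATA (rows of record 2026-08-19, `pub-rhpf-cand-6/out/g6_paritymass_census.json`; DATA, not PROVED): `ζ`'s bottom profiles SATURATE the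
sharp law at depth — `m_ev(u₁⁺) ≥ 1/2` and `m_om(u₁⁻) ≥ 1/2` on all 865 rows of record with minimum `0.500000000000011` at
`(a, N) = (2.0, 880)`: the half-period autocorrelation of `ζ`'s ground profile is `≥ 0` everywhere (as nodelessness forces) and
`→ 0⁺` at depth (the profile becomes `L²`-orthogonal to its half-period translate — localisation on a scale `< L/2`); the flip
dials `rmf-flip-p{2,3,5}` have `m_ev = 0.0085 / 2·10⁻⁵ / 7.7·10⁻⁴` at their mirror windows (autocorrelation `≈ −1`: an
anti-periodic ground profile). Harness instruments: `cand6-017` (threshold `1/8`), `cand6-018` (threshold `1/2`, this file).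
-/

set_option linter.dupNamespace false  -- the mandated namespace repeats `RiemannHypothesis`

noncomputable section

open Real Set Matrix Finset

namespace Summit.RiemannHypothesis.RiemannHypothesis.Theorems.PfPersistence

/-! ## §1 A real-number lemma: the product of two floor-one-signed values -/

/-- PROVED: if `a, b` are both `≥ −c` or both `≤ c` (`c ≥ 0`) and `|a|, |b| ≤ M`, then `a b ≥ −(2 c M + c²)`. [folklore] -/
theorem mul_ge_of_floorSigns {a b c M : ℝ} (hc : 0 ≤ c) (ha : |a| ≤ M) (hb : |b| ≤ M)
    (h : (-c ≤ a ∧ -c ≤ b) ∨ (a ≤ c ∧ b ≤ c)) : -(2 * c * M + c ^ 2) ≤ a * b := by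
  have ha' := abs_le.1 ha
  have hb' := abs_le.1 hb
  rcases h with ⟨h1, h2⟩ | ⟨h1, h2⟩
  · nlinarith [mul_nonneg (by linarith : 0 ≤ a + c) (by linarith : 0 ≤ b + c)]
  · nlinarith [mul_nonneg (by linarith : 0 ≤ c - a) (by linarith : 0 ≤ c - b)]

/-! ## §2 Even sector -/

/-- PROVED (bilinear Parseval): `∫_{-L/2}^{L/2} θ_u θ_v = u ⬝ᵥ v` (`0 < L`). [folklore] -/
theorem integral_profile_mul_profile {L : ℝ} (hL : 0 < L) {N : ℕ} (u v : Fin (N + 1) → ℝ) :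
    ∫ x in (-(L / 2))..(L / 2), profile L u x * profile L v x = u ⬝ᵥ v := by
  have hint : ∀ x, profile L u x * profile L v x
      = ∑ n : Fin (N + 1), ∑ m : Fin (N + 1), u n * v m * (xiEven L n x * xiEven L m x) := by
    intro x; unfold profile; rw [Finset.sum_mul_sum]
    exact Finset.sum_congr rfl fun n _ => Finset.sum_congr rfl fun m _ => by ring
  simp_rw [hint]
  rw [intervalIntegral.integral_finsetSum
    (f := fun (n : Fin (N + 1)) x => ∑ m : Fin (N + 1), u n * v m * (xiEven L n x * xiEven L m x))
    (fun n _ => Continuous.intervalIntegrable (by fun_prop) _ _)]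
  have hrow : ∀ n : Fin (N + 1),
      ∫ x in (-(L / 2))..(L / 2), ∑ m : Fin (N + 1), u n * v m * (xiEven L n x * xiEven L m x)
        = u n * v n := by
    intro n
    rw [intervalIntegral.integral_finsetSum
      (f := fun (m : Fin (N + 1)) x => u n * v m * (xiEven L n x * xiEven L m x))
      (fun m _ => Continuous.intervalIntegrable (by fun_prop) _ _)]
    simp_rw [intervalIntegral.integral_const_mul, CentralMassFloor.integral_xiEven_mul_xiEven hL]
    simp only [Fin.val_inj, mul_ite, mul_one, mul_zero, Finset.sum_ite_eq, Finset.mem_univ, if_true]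
  simp_rw [hrow]
  simp only [dotProduct]

/-- PROVED: `2 ‖u^{ev}‖² = ‖u‖² + ⟨u, flip u⟩`. [folklore] -/
theorem two_mul_evenMass_eq {N : ℕ} (u : Fin (N + 1) → ℝ) :
    2 * (evenIdxPart u ⬝ᵥ evenIdxPart u) = u ⬝ᵥ u + u ⬝ᵥ flipVec u := by
  simp only [dotProduct, ← Finset.sum_add_distrib, Finset.mul_sum]
  refine Finset.sum_congr rfl fun n _ => ?_
  unfold evenIdxPart flipVec
  rcases Nat.even_or_odd (n : ℕ) with h | h
  · rw [if_pos h, h.neg_one_pow]; ring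
  · rw [if_neg (Nat.not_even_iff_odd.2 h), h.neg_one_pow]; ring

/-- **PROVED — `⟨u, flip u⟩` IS THE HALF-PERIOD AUTOCORRELATION of the profile:**
`u ⬝ᵥ flip u = ∫_{-L/2}^{L/2} θ_u(x) θ_u(x + L/2) dx` (`0 < L`). [folklore] -/
theorem dotProduct_flipVec_eq_integral {L : ℝ} (hL : 0 < L) {N : ℕ} (u : Fin (N + 1) → ℝ) :
    u ⬝ᵥ flipVec u = ∫ x in (-(L / 2))..(L / 2), profile L u x * profile L u (x + L / 2) := by
  rw [← integral_profile_mul_profile hL]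
  refine intervalIntegral.integral_congr fun x _ => ?_
  simp only [profile_add_half hL.ne']

/-- PROVED: for a ONE-SIGNED profile the half-period autocorrelation integrand is `≥ 0` on the window. [folklore] -/
theorem profile_mul_flip_nonneg_of_oneSigned {L : ℝ} (hL : 0 < L) {N : ℕ} {u : Fin (N + 1) → ℝ} (h : OneSigned L u)
    {x : ℝ} (hx : x ∈ Icc (-(L / 2)) (L / 2)) : 0 ≤ profile L u x * profile L (flipVec u) x := by
  obtain ⟨x', hx', hval⟩ := exists_halfPeriod_partner hL u hx
  rw [← hval]
  rcases h with h | h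
  · exact mul_nonneg (h x hx) (h x' hx')
  · exact mul_nonneg_of_nonpos_of_nonpos (h x hx) (h x' hx')

/-- PROVED: `OneSigned ⇒ 0 ≤ ⟨u, flip u⟩`. [folklore] -/
theorem dotProduct_flipVec_nonneg_of_oneSigned {L : ℝ} (hL : 0 < L) {N : ℕ} {u : Fin (N + 1) → ℝ}
    (h : OneSigned L u) : 0 ≤ u ⬝ᵥ flipVec u := by
  rw [← integral_profile_mul_profile hL]
  exact intervalIntegral.integral_nonneg (by linarith) fun x hx => profile_mul_flip_nonneg_of_oneSigned hL h hx

/-- **PROVED — THE SHARP PARITY-MASS LAW (even sector):** a one-signed profile keeps at least HALF of its mass on the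
even-indexed modes, `‖u‖² ≤ 2 ‖u^{ev}‖²`. [folklore] -/
theorem parityMass_two_le_of_oneSigned {L : ℝ} (hL : 0 < L) {N : ℕ} {u : Fin (N + 1) → ℝ} (h : OneSigned L u) :
    u ⬝ᵥ u ≤ 2 * (evenIdxPart u ⬝ᵥ evenIdxPart u) := by
  rw [two_mul_evenMass_eq]
  linarith [dotProduct_flipVec_nonneg_of_oneSigned hL h]

/-- PROVED (floored integrand bound): under `FloorOneSigned L φ u`, pointwise on the window
`θ_u(x) θ_{flip u}(x) ≥ −(2φ + φ²) (max |θ_u|)²`. [folklore] -/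
theorem profile_mul_flip_ge_of_floorOneSigned {L φ : ℝ} (hL : 0 < L) (hφ : 0 ≤ φ) {N : ℕ} {u : Fin (N + 1) → ℝ}
    (h : FloorOneSigned L φ u) {x : ℝ} (hx : x ∈ Icc (-(L / 2)) (L / 2)) :
    -((2 * φ + φ ^ 2) * profileMax L u ^ 2) ≤ profile L u x * profile L (flipVec u) x := by
  obtain ⟨x', hx', hval⟩ := exists_halfPeriod_partner hL u hx
  rw [← hval]
  set M := profileMax L u with hM
  have hM0 : 0 ≤ M := profileMax_nonneg L u
  have key := mul_ge_of_floorSigns (c := φ * M) (mul_nonneg hφ hM0) (abs_profile_le_profileMax L u hx)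
    (abs_profile_le_profileMax L u hx') (by
      rcases h with h | h
      · exact Or.inl ⟨h x hx, h x' hx'⟩
      · exact Or.inr ⟨h x hx, h x' hx'⟩)
  calc -((2 * φ + φ ^ 2) * M ^ 2) = -(2 * (φ * M) * M + (φ * M) ^ 2) := by ring
    _ ≤ _ := key

/-- PROVED: `FloorOneSigned L φ u ⇒ ⟨u, flip u⟩ ≥ −(2φ + φ²)(2N+1) ‖u‖²`. [folklore] -/
theorem dotProduct_flipVec_ge_of_floorOneSigned {L φ : ℝ} (hL : 0 < L) (hφ : 0 ≤ φ) {N : ℕ} {u : Fin (N + 1) → ℝ}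
    (h : FloorOneSigned L φ u) : -((2 * φ + φ ^ 2) * (2 * N + 1) * (u ⬝ᵥ u)) ≤ u ⬝ᵥ flipVec u := by
  set M := profileMax L u with hM
  have hc : 0 ≤ (2 * φ + φ ^ 2) := by positivity
  have hM2 : M ^ 2 * L ≤ (u ⬝ᵥ u) * (2 * N + 1) := by
    have := profileMax_sq_le hL u
    calc M ^ 2 * L ≤ (u ⬝ᵥ u) * ((2 * N + 1) / L) * L := mul_le_mul_of_nonneg_right this hL.le
      _ = (u ⬝ᵥ u) * (2 * N + 1) := by field_simp
  have hint : ∫ x in (-(L / 2))..(L / 2), (-((2 * φ + φ ^ 2) * M ^ 2) : ℝ)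
      ≤ ∫ x in (-(L / 2))..(L / 2), profile L u x * profile L (flipVec u) x :=
    intervalIntegral.integral_mono_on (by linarith) (by simp)
      ((Continuous.intervalIntegrable (by
        have := CentralMassFloor.continuous_profile L u
        have := CentralMassFloor.continuous_profile L (flipVec u)
        fun_prop) _ _))
      fun x hx => profile_mul_flip_ge_of_floorOneSigned hL hφ h hx
  rw [intervalIntegral.integral_const, smul_eq_mul, integral_profile_mul_profile hL] at hint
  have hlen : L / 2 - -(L / 2) = L := by ring
  rw [hlen] at hint
  calc -((2 * φ + φ ^ 2) * (2 * N + 1) * (u ⬝ᵥ u)) ≤ -((2 * φ + φ ^ 2) * (M ^ 2 * L)) := by nlinarith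
    _ = L * -((2 * φ + φ ^ 2) * M ^ 2) := by ring
    _ ≤ u ⬝ᵥ flipVec u := hint

/-- **PROVED — THE SHARP PARITY-MASS LAW, floored:** `FloorOneSigned L φ u ⇒ (1 − (2φ + φ²)(2N+1)) ‖u‖² ≤ 2 ‖u^{ev}‖²`. [folklore] -/
theorem parityMass_two_le_of_floorOneSigned {L φ : ℝ} (hL : 0 < L) (hφ : 0 ≤ φ) {N : ℕ} {u : Fin (N + 1) → ℝ}
    (h : FloorOneSigned L φ u) :
    (1 - (2 * φ + φ ^ 2) * (2 * N + 1)) * (u ⬝ᵥ u) ≤ 2 * (evenIdxPart u ⬝ᵥ evenIdxPart u) := by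
  rw [two_mul_evenMass_eq]
  have := dotProduct_flipVec_ge_of_floorOneSigned hL hφ h
  linarith

/-! ## §3 Odd sector -/

/-- PROVED (bilinear sine Parseval): `∫_{-L/2}^{L/2} θ⁻_u θ⁻_v = u ⬝ᵥ v` (`0 < L`). [folklore] -/
theorem integral_profileOdd_mul_profileOdd {L : ℝ} (hL : 0 < L) {N : ℕ} (u v : Fin N → ℝ) :
    ∫ x in (-(L / 2))..(L / 2), profileOdd L u x * profileOdd L v x = u ⬝ᵥ v := by
  have hint : ∀ x, profileOdd L u x * profileOdd L v x
      = ∑ j : Fin N, ∑ m : Fin N, u j * v m * (xiOdd L ((j : ℕ) + 1) x * xiOdd L ((m : ℕ) + 1) x) := by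
    intro x; unfold profileOdd; rw [Finset.sum_mul_sum]
    exact Finset.sum_congr rfl fun j _ => Finset.sum_congr rfl fun m _ => by ring
  simp_rw [hint]
  rw [intervalIntegral.integral_finsetSum
    (f := fun (j : Fin N) x => ∑ m : Fin N, u j * v m * (xiOdd L ((j : ℕ) + 1) x * xiOdd L ((m : ℕ) + 1) x))
    (fun j _ => Continuous.intervalIntegrable (by fun_prop) _ _)]
  have hrow : ∀ j : Fin N,
      ∫ x in (-(L / 2))..(L / 2), ∑ m : Fin N, u j * v m * (xiOdd L ((j : ℕ) + 1) x * xiOdd L ((m : ℕ) + 1) x)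
        = u j * v j := by
    intro j
    rw [intervalIntegral.integral_finsetSum
      (f := fun (m : Fin N) x => u j * v m * (xiOdd L ((j : ℕ) + 1) x * xiOdd L ((m : ℕ) + 1) x))
      (fun m _ => Continuous.intervalIntegrable (by fun_prop) _ _)]
    simp_rw [intervalIntegral.integral_const_mul,
      integral_xiOdd_mul_xiOdd hL (Nat.succ_ne_zero _) (Nat.succ_ne_zero _)]
    simp only [Nat.succ_inj, Fin.val_inj, mul_ite, mul_one, mul_zero, Finset.sum_ite_eq, Finset.mem_univ, if_true]
  simp_rw [hrow]
  simp only [dotProduct]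

/-- PROVED: `2 ‖u^{om}‖² = ‖u‖² + ⟨u, flipOdd u⟩`. [folklore] -/
theorem two_mul_oddModeMass_eq {N : ℕ} (u : Fin N → ℝ) :
    2 * (oddModePart u ⬝ᵥ oddModePart u) = u ⬝ᵥ u + u ⬝ᵥ flipVecOdd u := by
  simp only [dotProduct, ← Finset.sum_add_distrib, Finset.mul_sum]
  refine Finset.sum_congr rfl fun j _ => ?_
  unfold oddModePart flipVecOdd
  rcases Nat.even_or_odd (j : ℕ) with h | h
  · rw [if_pos h, h.neg_one_pow]; ring
  · rw [if_neg (Nat.not_even_iff_odd.2 h), h.neg_one_pow]; ring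

/-- **PROVED — `⟨u, flipOdd u⟩` IS THE REFLECTION AUTOCORRELATION of the odd profile:**
`u ⬝ᵥ flipOdd u = ∫_{-L/2}^{L/2} θ⁻_u(x) θ⁻_u(L/2 − x) dx` (`0 < L`). [folklore] -/
theorem dotProduct_flipVecOdd_eq_integral {L : ℝ} (hL : 0 < L) {N : ℕ} (u : Fin N → ℝ) :
    u ⬝ᵥ flipVecOdd u = ∫ x in (-(L / 2))..(L / 2), profileOdd L u x * profileOdd L u (L / 2 - x) := by
  rw [← integral_profileOdd_mul_profileOdd hL]
  refine intervalIntegral.integral_congr fun x _ => ?_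
  simp only [profileOdd_half_sub hL.ne']

/-- PROVED: the reflection-autocorrelation integrand of an `H`-one-signed odd profile is `≥ 0` on the WHOLE window
(on `H` both factors live on `H`; off `H`, `θ⁻_u(x) θ⁻_{flipOdd u}(x) = θ⁻_u(−x) θ⁻_u(L/2 + x)` by antisymmetry). [folklore] -/
theorem profileOdd_mul_flip_nonneg_of_oneSignedOdd {L : ℝ} (hL : 0 < L) {N : ℕ} {u : Fin N → ℝ}
    (h : OneSignedOdd L u) {x : ℝ} (hx : x ∈ Icc (-(L / 2)) (L / 2)) :
    0 ≤ profileOdd L u x * profileOdd L (flipVecOdd u) x := by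
  have hsame : ∀ {y z : ℝ}, y ∈ Icc 0 (L / 2) → z ∈ Icc 0 (L / 2) →
      0 ≤ profileOdd L u y * profileOdd L u z := by
    intro y z hy hz
    rcases h with h | h
    · exact mul_nonneg (h y hy) (h z hz)
    · exact mul_nonneg_of_nonpos_of_nonpos (h y hy) (h z hz)
  by_cases hx0 : 0 ≤ x
  · rw [← profileOdd_half_sub hL.ne' u x]
    exact hsame ⟨hx0, hx.2⟩ ⟨by linarith [hx.2], by linarith⟩
  · have hx0 : x < 0 := lt_of_not_ge hx0
    have h1 : profileOdd L u x = -profileOdd L u (-x) := by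
      rw [profileOdd_neg]; ring
    have h2 : profileOdd L (flipVecOdd u) x = -profileOdd L u (L / 2 + x) := by
      have := profileOdd_half_sub hL.ne' u (-x)
      rw [profileOdd_neg] at this
      rw [show L / 2 + x = L / 2 - -x by ring]
      linarith
    rw [h1, h2, neg_mul_neg]
    exact hsame ⟨by linarith, by linarith [hx.1]⟩ ⟨by linarith [hx.1], by linarith⟩

/-- PROVED: `OneSignedOdd ⇒ 0 ≤ ⟨u, flipOdd u⟩`. [folklore] -/
theorem dotProduct_flipVecOdd_nonneg_of_oneSignedOdd {L : ℝ} (hL : 0 < L) {N : ℕ} {u : Fin N → ℝ}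
    (h : OneSignedOdd L u) : 0 ≤ u ⬝ᵥ flipVecOdd u := by
  rw [← integral_profileOdd_mul_profileOdd hL]
  exact intervalIntegral.integral_nonneg (by linarith)
    fun x hx => profileOdd_mul_flip_nonneg_of_oneSignedOdd hL h hx

/-- **PROVED — THE SHARP PARITY-MASS LAW (odd sector):** an `H`-one-signed odd profile keeps at least HALF of its mass on
the odd-n sine modes, `‖u‖² ≤ 2 ‖u^{om}‖²`. [folklore] -/
theorem parityMassOdd_two_le_of_oneSignedOdd {L : ℝ} (hL : 0 < L) {N : ℕ} {u : Fin N → ℝ} (h : OneSignedOdd L u) :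
    u ⬝ᵥ u ≤ 2 * (oddModePart u ⬝ᵥ oddModePart u) := by
  rw [two_mul_oddModeMass_eq]
  linarith [dotProduct_flipVecOdd_nonneg_of_oneSignedOdd hL h]

/-- PROVED (floored odd integrand bound): under `FloorOneSignedOdd L φ u`, pointwise on the whole window
`θ⁻_u(x) θ⁻_{flipOdd u}(x) ≥ −(2φ + φ²)(max_H |θ⁻_u|)²`. [folklore] -/
theorem profileOdd_mul_flip_ge_of_floorOneSignedOdd {L φ : ℝ} (hL : 0 < L) (hφ : 0 ≤ φ) {N : ℕ} {u : Fin N → ℝ}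
    (h : FloorOneSignedOdd L φ u) {x : ℝ} (hx : x ∈ Icc (-(L / 2)) (L / 2)) :
    -((2 * φ + φ ^ 2) * profileOddMax L u ^ 2) ≤ profileOdd L u x * profileOdd L (flipVecOdd u) x := by
  set M := profileOddMax L u with hM
  have hM0 : 0 ≤ M := profileOddMax_nonneg L u
  have hpair : ∀ {y z : ℝ}, y ∈ Icc 0 (L / 2) → z ∈ Icc 0 (L / 2) →
      -((2 * φ + φ ^ 2) * M ^ 2) ≤ profileOdd L u y * profileOdd L u z := by
    intro y z hy hz
    have key := mul_ge_of_floorSigns (c := φ * M) (mul_nonneg hφ hM0) (abs_profileOdd_le_profileOddMax L u hy)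
      (abs_profileOdd_le_profileOddMax L u hz) (by
        rcases h with h | h
        · exact Or.inl ⟨h y hy, h z hz⟩
        · exact Or.inr ⟨h y hy, h z hz⟩)
    calc -((2 * φ + φ ^ 2) * M ^ 2) = -(2 * (φ * M) * M + (φ * M) ^ 2) := by ring
      _ ≤ _ := key
  by_cases hx0 : 0 ≤ x
  · rw [← profileOdd_half_sub hL.ne' u x]
    exact hpair ⟨hx0, hx.2⟩ ⟨by linarith [hx.2], by linarith⟩
  · have hx0 : x < 0 := lt_of_not_ge hx0
    have h1 : profileOdd L u x = -profileOdd L u (-x) := by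
      rw [profileOdd_neg]; ring
    have h2 : profileOdd L (flipVecOdd u) x = -profileOdd L u (L / 2 + x) := by
      have := profileOdd_half_sub hL.ne' u (-x)
      rw [profileOdd_neg] at this
      rw [show L / 2 + x = L / 2 - -x by ring]
      linarith
    rw [h1, h2, neg_mul_neg]
    exact hpair ⟨by linarith, by linarith [hx.1]⟩ ⟨by linarith [hx.1], by linarith⟩

/-- PROVED: `FloorOneSignedOdd L φ u ⇒ ⟨u, flipOdd u⟩ ≥ −(2φ + φ²)·2N·‖u‖²`. [folklore] -/
theorem dotProduct_flipVecOdd_ge_of_floorOneSignedOdd {L φ : ℝ} (hL : 0 < L) (hφ : 0 ≤ φ) {N : ℕ} {u : Fin N → ℝ}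
    (h : FloorOneSignedOdd L φ u) : -((2 * φ + φ ^ 2) * (2 * N) * (u ⬝ᵥ u)) ≤ u ⬝ᵥ flipVecOdd u := by
  set M := profileOddMax L u with hM
  have hc : 0 ≤ (2 * φ + φ ^ 2) := by positivity
  have hM2 : M ^ 2 * L ≤ (u ⬝ᵥ u) * (2 * N) := by
    have := profileOddMax_sq_le hL u
    calc M ^ 2 * L ≤ (u ⬝ᵥ u) * (N * (2 / L)) * L := mul_le_mul_of_nonneg_right this hL.le
      _ = (u ⬝ᵥ u) * (2 * N) := by field_simp
  have hint : ∫ x in (-(L / 2))..(L / 2), (-((2 * φ + φ ^ 2) * M ^ 2) : ℝ)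
      ≤ ∫ x in (-(L / 2))..(L / 2), profileOdd L u x * profileOdd L (flipVecOdd u) x :=
    intervalIntegral.integral_mono_on (by linarith) (by simp)
      ((Continuous.intervalIntegrable (by
        have := continuous_profileOdd L u
        have := continuous_profileOdd L (flipVecOdd u)
        fun_prop) _ _))
      fun x hx => profileOdd_mul_flip_ge_of_floorOneSignedOdd hL hφ h hx
  rw [intervalIntegral.integral_const, smul_eq_mul, integral_profileOdd_mul_profileOdd hL] at hint
  have hlen : L / 2 - -(L / 2) = L := by ring
  rw [hlen] at hint
  calc -((2 * φ + φ ^ 2) * (2 * N) * (u ⬝ᵥ u)) ≤ -((2 * φ + φ ^ 2) * (M ^ 2 * L)) := by nlinarith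
    _ = L * -((2 * φ + φ ^ 2) * M ^ 2) := by ring
    _ ≤ u ⬝ᵥ flipVecOdd u := hint

/-- **PROVED — THE SHARP PARITY-MASS LAW (odd sector), floored:**
`FloorOneSignedOdd L φ u ⇒ (1 − (2φ + φ²)·2N) ‖u‖² ≤ 2 ‖u^{om}‖²`. [folklore] -/
theorem parityMassOdd_two_le_of_floorOneSignedOdd {L φ : ℝ} (hL : 0 < L) (hφ : 0 ≤ φ) {N : ℕ} {u : Fin N → ℝ}
    (h : FloorOneSignedOdd L φ u) :
    (1 - (2 * φ + φ ^ 2) * (2 * N)) * (u ⬝ᵥ u) ≤ 2 * (oddModePart u ⬝ᵥ oddModePart u) := by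
  rw [two_mul_oddModeMass_eq]
  have := dotProduct_flipVecOdd_ge_of_floorOneSignedOdd hL hφ h
  linarith

end Summit.RiemannHypothesis.RiemannHypothesis.Theorems.PfPersistence
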